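import Mathlib
import Summits.Ventures.FusionMHD.Models.CerfonFreidbergIterLikeQHalfShearDefs
import HarnessLib

/-!
# Ventures/FusionMHD — Models/CerfonFreidbergIterLikeQHalfShearPanels15.lean: KERNEL CHECK of the shear-register certificates of panels 28, 29 (of 32)
# at `ψ_N = 1/2` of THE Cerfon–Freidberg ITER-like instance

HONEST FRAMING (LADDER-GRIDFUSION three columns; CF rung; successor step of «q′(ψ_N = 1/2) on the CF rung», F2-SCOPING v1.6 §10(c)).  One `decide +kernel`
(≈ 95 s): for each listed panel the obligation `CFIterLike.QHalfShear.ShearCert.ok` (`Models/CerfonFreidbergIterLikeQHalfShearDefs.lean`) — the Taylor-model run of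
`progQ = CFIterLike.QHalf.progA ++ blockQ` over ★ #117's parameter box is ACCEPTED and the kernel's panel-integral enclosure of the shear kernel `K·p` along the
approximant lies inside the claimed integers (read off a compiled `#eval` of the same functions, slack one unit of `2⁻⁶⁰`; float truth inside every panel).
MODELLED: analytic Cerfon–Freidberg family; nothing about a device or stability.  No `native_decide`.  Typer/prover: gridfusion-model-5 (g8), 2026-08-27.
Citations: Freidberg 2014 §6.3.5 (6.35) [Freidberg2014]; Mahboubi–Melquiond–Sibut-Pinote 2016 §3.2 Lemma 3 [MahboubiMelquiondSibutpinote2016].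
-/

namespace Summit.Ventures.FusionMHD.Models.CFIterLike.QHalfShear

/-- Shear-register certificate data of panels 28, 29. [instance data] -/
def shearCert15 : List ShearCert := [
  { j := 28, cand := [870230536419482533888, -2377174170754471165952, 14045034956973810909184, -30661640444804245487616, 85311926874498649817088, -33908251535884375031808, -471745650697591500832768, 3580338208096376770789376, -15415341466166725296783360, 69166040443852190031806464, 965266818544096326543474688, -25689927559843119480698830848, -1555154971723839266239639715840],
    deg := 10, elog2 := 43, plo := 6261442776320289577, phi := 6261442957572111902 },
  { j := 29, cand := [808803980806591217664, -1579000273804849053696, 11655181543848680620032, -20518749518506296868864, 76090462518139823325184, -69460346233848493768704, 6134524796326230622208, 1175683450772987995750400, -6008666594762863337799680, 27803208632627485760028672, 1463971945838785314204680192, -9621375309758409835429232640, -1938039127481739854782440407040],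
    deg := 12, elog2 := 43, plo := 5869241812775795795, phi := 5869241986686743854 }]

/-- **KERNEL CHECK** of the shear register on panels 28, 29. -/
theorem shearCert15_ok : CFIterLike.QHalfShear.shearCert15.all ShearCert.ok = true := by
  decide +kernel

end Summit.Ventures.FusionMHD.Models.CFIterLike.QHalfShear
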